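/-
Copyright (c) 2026 the pub-hodgecm-mathlib formalisation cell (harness21).  Prover seat hodgecm-mathlib-K2Liu-p12 (g2): Track B «K2-LIT»,
#184♮ = hLiu418 = stmt-HodgeConjecture-24832; Road Φ of socket #41, organ Φ4-EXACT (LEAD F0P6-plan ruling «M-157p»), file E6-split.
-/
import Summits.HodgeConjecture.HodgeConjecture.Theorems.K2LiuGoodPlaceWhittakerUnimodularValue   -- ★ E5: the assembly engine
import Summits.HodgeConjecture.HodgeConjecture.Theorems.K2LiuSkewResidueQuadricSplit           -- ★ E4 (K2Liu-p10): `I(1,1) = −q_v μ(B0)` at a split place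
import HarnessLib

/-!
# Crux `HLiu418`, Road Φ of socket #41, organ Φ4-EXACT — FILE E6 (split): THE UNIMODULAR UNRAMIFIED WHITTAKER VALUE AT A SPLIT PLACE

Cell `hodgecm-mathlib`, crux item hLiu418 = `stmt-HodgeConjecture-24832`, route of record `HCCMUnconditional`; squad K2 ∕ K2Liu, road `K2_Liu`,
socket #41 `sig_K2LiuSiegelEisensteinContinuation`, Road Φ, organ Φ4-EXACT (ruling M-157p; method memo `K2/K2Liu-p12/g2/CENSUS-PHI4-EXACT-Method.K2Liu-p12-g2.md`).
THEOREMS ONLY (no `def`, no `instance`, no `notation`, no named-fact hypothesis, no `sorry`); lane `--supports stmt-HodgeConjecture-24832`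
(count-neutral helper; closes no socket by itself).

THE STATEMENT.  At a good place `v` of `F` SPLIT in `E` (`c • w₀ ≠ w₀`), for the spherical section `φ_s` of `I_v(s,χ_v)` (`χ_w` unramified), `ψ_v` of
conductor `0`, and a `v`-unimodular `T`-skew Fourier index `β`:
  **`∫_{B(−3)} φ_s(w_Δ n t) ψ_v(−τ tr(βt)) dμ(t) = μ(B(0)) · (1 − t)(1 − q_v t)`**,  `t = (∏_{w∣v} χ_w(ι_w ϖ))·(∏_{w∣v} ‖ι_w ϖ‖_w)^{s+1}`, `q_v = v.residueCard`
— ★ E5 `setIntegral_whittaker_unimodular_eq` fed with K2Liu-p10's ★ E4 `setIntegral_ball_inter_det_eq_split` (`C = −q_v`).  With the CM letters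
(`∏ χ_w(ι_w ϖ) = 1 = η_v`, `∏ ‖ι_w ϖ‖_w = q_v^{−2}`) this is `μ(B(0))·(1 − q_v^{−(2s+1)})(1 − q_v^{−(2s+2)}) = μ(B(0))·b_v(s)⁻¹` (★ O41.6 letters, `ε_v(ϖ) = +1`).

## References
* [Shimura1997] G. Shimura, *Euler Products and Eisenstein Series*, CBMS 93 (1997), Thm. 13.6, Prop. 14.9.
* [KudlaSweet1997] S. Kudla, W. J. Sweet, Israel J. Math. 98 (1997), §1.   * [Liu2011] Y. Liu, Algebra Number Theory 5 (2011), §2A (2-2), (2-10).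
-/

set_option autoImplicit false
-- the mandated namespace repeats the single-problem summit's segment (`HodgeConjecture.HodgeConjecture`)
set_option linter.dupNamespace false

noncomputable section

open scoped NNReal ENNReal Matrix Topology
open NumberField IsDedekindDomain Matrix MeasureTheory Set Filter
open Literature.NumberTheory.Automorphic Literature.NumberTheory.Automorphic.UnitaryGroup
open Literature.NumberTheory.GelbartRogawski1991.AdaptedBlocks
open Literature.NumberTheory.GelbartRogawski1991.UnitaryDualPair.LocalSplitting
open Literature.NumberTheory.K2Lit.LocalSiegelDoubled
open Summit.HodgeConjecture.HodgeConjecture.Cruxes.HLiu418.K2LiuGoodPlaceWhittakerUnimodularValue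
open Summit.HodgeConjecture.HodgeConjecture.Cruxes.HLiu418.K2LiuSkewResidueQuadricSplit

namespace Summit.HodgeConjecture.HodgeConjecture.Cruxes.HLiu418.K2LiuGoodPlaceWhittakerUnimodularValueSplit

variable (F : Type) [Field F] [NumberField F] (E : Type) [Field E] [NumberField E] [Algebra F E]
  [Algebra.IsQuadraticExtension F E] (c : E ≃ₐ[F] E) {δ : E} (hcδ : c δ = -δ) (hδ : δ ≠ 0) {dd : F} (hd : δ * δ = algebraMap F E dd)
  (v : HeightOneSpectrum (𝓞 F)) {T₀ : Matrix (Fin 2) (Fin 2) F}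
  (hT₀ : T₀.IsSymm) (hT₀d : IsUnit T₀.det)
  {JD : Matrix (Fin (2 + 2)) (Fin (2 + 2)) E} (hJD : JD = (gramD F 2 T₀).map (algebraMap F E))
  {π : v.adicCompletion F} (hπ : Valued.v π = WithZero.exp (-1 : ℤ)) (hπw : ∀ w : PlacesOver E v, Valued.v (toPlace v w π) = WithZero.exp (-1 : ℤ))
  (w₀ : PlacesOver E v) (hw₀ : c • w₀.1 ≠ w₀.1)

include hcδ hδ hd hT₀ hT₀d hJD hπ hπw hw₀ in
/-- **THE UNIMODULAR VALUE OF THE UNRAMIFIED WHITTAKER COEFFICIENT AT A SPLIT PLACE**: `∫_{B(−3)} φ_s(w_Δ n t)·ψ_v(−τ tr(βt)) dμ =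
μ(B(0))·(1 − t)(1 − q_v t)`, `t = (∏_w χ_w(ι_w ϖ))·(∏_w ‖ι_w ϖ‖_w)^{s+1}` — ★ E5 engine + ★ E4 (K2Liu-p10) `I(1,1) = −q_v μ(B(0))`.
[cite: Shimura1997, Thm. 13.6] [cite: KudlaSweet1997, §1] [cite: Liu2011, §2A (2-2)] -/
theorem setIntegral_whittaker_unimodular_eq_split
    (S : AddSubgroup (Matrix (Fin 2) (Fin 2) (LocalRing E v)))
    (hS : ∀ t, t ∈ S ↔ (t.map (conjLocal E c v))ᵀ * gramS F E v 2 T₀ + gramS F E v 2 T₀ * t = 0)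
    [MeasurableSpace S] [BorelSpace S] (μ : Measure S) [μ.IsAddHaarMeasure]
    (h2v : ∀ w : PlacesOver E v, ValuativeRel.valuation (w.1.adicCompletion E) (2 : w.1.adicCompletion E) = 1)
    (hT : ∀ (w : PlacesOver E v) (i j : Fin 2),
      ValuativeRel.valuation (w.1.adicCompletion E) (algebraMap E (w.1.adicCompletion E) (algebraMap F E (T₀ i j))) ≤ 1)
    (hTinv : ∀ (w : PlacesOver E v) (i j : Fin 2),
      ValuativeRel.valuation (w.1.adicCompletion E) (algebraMap E (w.1.adicCompletion E) (algebraMap F E (T₀⁻¹ i j))) ≤ 1)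
    (hTb : ∀ i j (w : PlacesOver E v), Valued.v (gramS F E v 2 T₀ i j w) ≤ Valued.v (toPlace v w π) ^ (0 : ℤ))
    (hTib : ∀ i j (w : PlacesOver E v), Valued.v ((gramS F E v 2 T₀)⁻¹ i j w) ≤ Valued.v (toPlace v w π) ^ (0 : ℤ))
    {χv : ∀ w : PlacesOver E v, (w.1.adicCompletion E)ˣ →* ℂˣ}
    (hχur : ∀ (w : PlacesOver E v) (x : (w.1.adicCompletion E)ˣ), Valued.v (x : w.1.adicCompletion E) = 1 → χv w x = 1)
    (hϖ0 : ∀ w : PlacesOver E v, toPlace v w π ≠ 0)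
    {s : ℂ} {φs : UnitaryGroup.localPi E c (2 + 2) JD v → ℂ} (hφ : IsSphericalSection F E c hcδ hδ hd v 2 hT₀ hJD χv s φs)
    {ψ : AddChar (v.adicCompletion F) Circle} (hψ : Continuous ψ) (hdψ : ψ.HasConductorExp 0)
    {τ : LocalRing E v → v.adicCompletion F} (hτ : ∀ r, toLocalRing E v (τ r) = r + conjLocal E c v r) (hτadd : ∀ r s, τ (r + s) = τ r + τ s)
    (hτs : ∀ (z : v.adicCompletion F) (r : LocalRing E v), τ (toLocalRing E v z * r) = z * τ r) (hτc : Continuous τ)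
    (h2F : Valued.v (2 : v.adicCompletion F) = 1)
    {ε : LocalRing E v} (hεσ : conjLocal E c v ε = -ε) (hεint : ∀ w : PlacesOver E v, Valued.v (ε w) ≤ 1)
    (hε : ∀ w : PlacesOver E v, Valued.v (toPlace v w π) ^ (0 : ℤ) ≤ Valued.v ((2 * ε) w))
    (h2 : ∀ w : PlacesOver E v, Valued.v (toPlace v w π) ^ (0 : ℤ) ≤ Valued.v ((2 : LocalRing E v) w))
    {β βinv : Matrix (Fin 2) (Fin 2) (LocalRing E v)} (hβs : (β.map (conjLocal E c v))ᵀ * gramS F E v 2 T₀ + gramS F E v 2 T₀ * β = 0)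
    (hββ : β * βinv = 1) (hβ0 : ∀ i j (w : PlacesOver E v), Valued.v (β i j w) ≤ Valued.v (toPlace v w π) ^ (0 : ℤ))
    (hβinv0 : ∀ i j (w : PlacesOver E v), Valued.v (βinv i j w) ≤ Valued.v (toPlace v w π) ^ (0 : ℤ))
 :
    ∫ t in {t : S | ∀ i j (w : PlacesOver E v), Valued.v (t.1 i j w) ≤ Valued.v (toPlace v w π) ^ (-3 : ℤ)},
        φs (weylDelta F E c v 2 hJD * nElem F E c v 2 hJD t.1 ((hS t.1).1 t.2)) * ((ψ (-τ (Matrix.trace (β * t.1))) : Circle) : ℂ) ∂μ =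
      (μ.real {t : S | ∀ i j (w : PlacesOver E v), Valued.v (t.1 i j w) ≤ Valued.v (toPlace v w π) ^ (0 : ℤ)} : ℂ) *
        ((1 - ((((∏ w : PlacesOver E v, χv w (Units.mk0 (toPlace v w π) (hϖ0 w))) : ℂˣ) : ℂ) *
          (((∏ w : PlacesOver E v, ‖toPlace v w π‖) : ℝ) : ℂ) ^ (s + 1))) *
          (1 - (v.residueCard : ℂ) * ((((∏ w : PlacesOver E v, χv w (Units.mk0 (toPlace v w π) (hϖ0 w))) : ℂˣ) : ℂ) *
          (((∏ w : PlacesOver E v, ‖toPlace v w π‖) : ℝ) : ℂ) ^ (s + 1)))) := by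
  have hI11 := setIntegral_ball_inter_det_eq_split F E c hcδ hδ hd v hT₀ hT₀d hπ w₀ hw₀ S hS μ hdψ hτ hβs hββ hβ0 hβinv0 h2v hTb hTib
  have h := setIntegral_whittaker_unimodular_eq F E c hcδ hδ hd v hT₀ hT₀d hJD hπ hπw S hS μ h2v hT hTinv hTb hTib hχur hϖ0 hφ hψ hdψ hτ hτadd hτs hτc
    h2F hεσ hεint hε h2 hβs hββ hβ0 hβinv0 (-(v.residueCard : ℂ)) hI11
  rw [h]
  ring

end Summit.HodgeConjecture.HodgeConjecture.Cruxes.HLiu418.K2LiuGoodPlaceWhittakerUnimodularValueSplit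

end
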